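import Summits.BirchSwinnertonDyer.BirchSwinnertonDyer.Theses.ClassRecordThree
import Summits.BirchSwinnertonDyer.BirchSwinnertonDyer.Theses.KolyvaginRoadThree
import Summits.BirchSwinnertonDyer.BirchSwinnertonDyer.Theorems.ClassRecordThreeEulerHalvesAtThreeCoStepLDefs
import Summits.BirchSwinnertonDyer.BirchSwinnertonDyer.Theorems.ClassRecordThreeEulerHalvesAtThreeResidualUpperBoundDefs
import Summits.BirchSwinnertonDyer.BirchSwinnertonDyer.Theorems.ClassRecordThreeEulerHalvesAtThreeResidualUpperBoundClosers
import Summits.BirchSwinnertonDyer.BirchSwinnertonDyer.Theorems.ClassRecordThreeEulerHalvesAtThreeHybridInertSavingServable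
import Literature.NumberTheory.EllipticCurves.ModularityVersionApProofs
import Literature.NumberTheory.EllipticCurves.TamagawaProofs
import Literature.NumberTheory.EllipticCurves.OggFormulaTameTypesTwoProofs
import Literature.NumberTheory.EllipticCurves.SzpiroLocalDataProofs
import Literature.NumberTheory.DiophantineGeometry.ConductorRingOfIntegersProofs
import Literature.NumberTheory.DiophantineGeometry.ConductorTameProofs
import HarnessLib

/-!
# The residue of crux 19109 `EulerHalvesAtThree` OFF the Cartan road is EMPTY (sorry-free)

Ideator seat `bsd-idea-10` (g8; write-crux `stmt-BirchSwinnertonDyer-19109`), for the line owner `bsd-stepL-tam3-p1` and the route pens.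
The tree carries bsd-idea-10's predicate `Three.CartanServableAtThree` VERBATIM (p659207), the Cartan road `Three.CartanRoadAtThree`
(displayed from its inputs by `CartanKernel.cartanRoadAtThree_of_inputs`, p662140) and two `@[conjecture]` residue constants OFF that road,
`Three.CoStepLResidualOffCartanAtThree` (IMC-form) and `ResidualUpperBoundOffCartanAtThree` (output form). §C proves the frame recipe of
the dossier `Cruxes/EulerHalvesAtThree/CartanServability.md` (Table 2.1) with every local input discharged from the tree (incl. Lemma W:
an additive `3`-carrier at `2` has `v₂(N) = 2`; additive `3`-carriers `q ≥ 5` are tame): `ClassX11b W 3 → Three.ResidualNormalFormAt W →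
Three.CartanServableAtThree W`. §R: BOTH residue constants hold OUTRIGHT (vacuously); (Z) `EulerHalvesAtThreeResidualUpperBound` follows from
`CartanRoadAtThree` alone; `eulerHalvesAtThree_of_items_of_cartanRoad` gives crux 19109 BY NAME from its seven print ∕ aside ∕ support items and
`Three.CartanRoadAtThree` — no IMC-grade binder (item 23334 does not occur); KR3 twin. CONDITIONAL results are marked; §R's residue theorems
are unconditional. Nothing is asserted about any particular curve; BSD is proved for no curve; no summit statement is proved by this file.
-/

set_option linter.dupNamespace false
set_option autoImplicit false

noncomputable section

open scoped Classical NumberField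

namespace Summit.BirchSwinnertonDyer.BirchSwinnertonDyer.Theorems.CartanResidueEmpty

open WeierstrassCurve IsDedekindDomain NumberField Field Literature.NumberTheory.EllipticCurves
open Literature.NumberTheory.EllipticCurves.Rank1Residual Literature.NumberTheory.EllipticCurves.Rank1Residual.Typed
open Summit.BirchSwinnertonDyer.Rank1Residual Summit.BirchSwinnertonDyer.Rank1Residual.X11b.Three
open Summit.BirchSwinnertonDyer.BirchSwinnertonDyer.Theorems
/-! ### §C. The frame recipe: one additive `3`-carrier makes the curve Cartan-servable (over the TREE predicate `Three.CartanServableAtThree`) -/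

/-- **Theorem (Corollary R, combinatorial core).** With `3` multiplicative, the local facts and the Cartan-placement facts as hypotheses, ONE additive
`3`-carrier `q₀ ≠ 3` makes the curve Cartan-servable. [cite: SilvermanATAEC1994, IV.9.4 (Tate's algorithm, table 4.1) and Cor. IV.9.2(d)] -/
theorem cartanServable_of_additiveCarrier
    (W : WeierstrassCurve ℚ) [W.IsElliptic] [W.IsGloballyMinimal]
    (h3 : Mult W 3)
    (hmultbad : ∀ (ℓ : ℕ) [Fact ℓ.Prime], Mult W ℓ → ¬ W.HasGoodReductionAtPrime ℓ)
    (hbad : ∀ (q : ℕ) [Fact q.Prime], 3 ∣ (W.baseChange ℚ_[q]).localTamagawaNumber ℤ_[q] →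
      ¬ W.HasGoodReductionAtPrime q)
    (h3split : 3 ∣ (W.baseChange ℚ_[3]).localTamagawaNumber ℤ_[3] → W.HasSplitMultiplicativeReductionAtPrime 3)
    (hsplitc : ∀ (q : ℕ) [Fact q.Prime], W.HasSplitMultiplicativeReductionAtPrime q →
      3 ∣ (W.baseChange ℚ_[q]).localTamagawaNumber ℤ_[q] → 3 ∣ padicValInt q W.minimalDiscriminantInt)
    (htame : ∀ (q : ℕ) [Fact q.Prime], q ≠ 2 → q ≠ 3 → 3 ∣ (W.baseChange ℚ_[q]).localTamagawaNumber ℤ_[q] →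
      ¬ W.HasSplitMultiplicativeReductionAtPrime q → q ^ 2 ∣ W.conductorNorm ℤ ∧ ¬ q ^ 3 ∣ W.conductorNorm ℤ)
    (hW : 3 ∣ (W.baseChange ℚ_[2]).localTamagawaNumber ℤ_[2] → ¬ W.HasSplitMultiplicativeReductionAtPrime 2 →
      2 ^ 2 ∣ W.conductorNorm ℤ ∧ ¬ 2 ^ 3 ∣ W.conductorNorm ℤ)
    (hfin : ∃ P : Finset ℕ, ∀ (q : ℕ) [Fact q.Prime], ¬ W.HasGoodReductionAtPrime q → q ∈ P)
    (hA : ∃ (q₀ : ℕ) (_ : Fact q₀.Prime), q₀ ≠ 3 ∧ 3 ∣ (W.baseChange ℚ_[q₀]).localTamagawaNumber ℤ_[q₀] ∧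
      ¬ W.HasSplitMultiplicativeReductionAtPrime q₀) :
    CartanServableAtThree W := by
  classical
  have hsplit : ∀ (ℓ : ℕ) [Fact ℓ.Prime], W.HasSplitMultiplicativeReductionAtPrime ℓ → Mult W ℓ :=
    fun ℓ _ h => h.hasMultiplicativeReductionAtPrime
  obtain ⟨P, hP⟩ := hfin
  -- `A` = the Cartan places (additive `3`-carriers `≠ 3`), `B` = the split `3`-carriers `≠ 3`
  obtain ⟨A, hAm⟩ : ∃ A : Finset ℕ, ∀ q, q ∈ A ↔ q ∈ P ∧ ∃ _ : Fact q.Prime, q ≠ 3 ∧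
      3 ∣ (W.baseChange ℚ_[q]).localTamagawaNumber ℤ_[q] ∧ ¬ W.HasSplitMultiplicativeReductionAtPrime q :=
    ⟨P.filter (fun q => ∃ _ : Fact q.Prime, q ≠ 3 ∧
      3 ∣ (W.baseChange ℚ_[q]).localTamagawaNumber ℤ_[q] ∧ ¬ W.HasSplitMultiplicativeReductionAtPrime q),
      fun q => Finset.mem_filter⟩
  obtain ⟨B, hBm⟩ : ∃ B : Finset ℕ, ∀ q, q ∈ B ↔ q ∈ P ∧ ∃ _ : Fact q.Prime, q ≠ 3 ∧
      W.HasSplitMultiplicativeReductionAtPrime q ∧ 3 ∣ padicValInt q W.minimalDiscriminantInt :=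
    ⟨P.filter (fun q => ∃ _ : Fact q.Prime, q ≠ 3 ∧
      W.HasSplitMultiplicativeReductionAtPrime q ∧ 3 ∣ padicValInt q W.minimalDiscriminantInt),
      fun q => Finset.mem_filter⟩
  -- the (C) clause for every Cartan place
  have hAspec : ∀ q ∈ A, ∃ _ : Fact q.Prime, q ≠ 3 ∧ q ^ 2 ∣ W.conductorNorm ℤ ∧ ¬ q ^ 3 ∣ W.conductorNorm ℤ ∧
      3 ∣ (W.baseChange ℚ_[q]).localTamagawaNumber ℤ_[q] := by
    intro q hq
    obtain ⟨-, hF, hq3, hc, hns⟩ := (hAm q).mp hq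
    by_cases hq2 : q = 2
    · subst hq2
      exact ⟨hF, hq3, (hW hc hns).1, (hW hc hns).2, hc⟩
    · exact ⟨hF, hq3, (htame q hq2 hq3 hc hns).1, (htame q hq2 hq3 hc hns).2, hc⟩
  -- every additive carrier `≠ 3` is in `A`; every split carrier `≠ 3` is in `B`; `3 ∉ B`
  have hAin : ∀ (q : ℕ) [Fact q.Prime], q ≠ 3 → 3 ∣ (W.baseChange ℚ_[q]).localTamagawaNumber ℤ_[q] →
      ¬ W.HasSplitMultiplicativeReductionAtPrime q → q ∈ A :=
    fun q hF hq3 hc hns => (hAm q).mpr ⟨hP q (hbad q hc), hF, hq3, hc, hns⟩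
  have hBin : ∀ (ℓ : ℕ) [Fact ℓ.Prime], ℓ ≠ 3 → W.HasSplitMultiplicativeReductionAtPrime ℓ →
      3 ∣ padicValInt ℓ W.minimalDiscriminantInt → ℓ ∈ B :=
    fun ℓ hF hℓ3 hsp hv => (hBm ℓ).mpr ⟨hP ℓ (hmultbad ℓ (hsplit ℓ hsp)), hF, hℓ3, hsp, hv⟩
  have h3B : (3 : ℕ) ∉ B := fun h => by
    obtain ⟨-, -, h33, -, -⟩ := (hBm 3).mp h
    exact h33 rfl
  have hBmult : ∀ ℓ ∈ B, ∃ _ : Fact ℓ.Prime, Mult W ℓ := fun ℓ hℓ => by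
    obtain ⟨-, hF, -, hsp, -⟩ := (hBm ℓ).mp hℓ
    exact ⟨hF, hsplit ℓ hsp⟩
  -- an off-`A` `3`-carrier is `3` itself (then split, by Fact T) or split
  have hoffA : ∀ (q : ℕ) [Fact q.Prime], q ∉ A → 3 ∣ (W.baseChange ℚ_[q]).localTamagawaNumber ℤ_[q] →
      W.HasSplitMultiplicativeReductionAtPrime q := by
    intro q hF hqA hc
    by_contra hns
    by_cases hq3 : q = 3
    · subst hq3
      exact hns (h3split hc)
    · exact hqA (hAin q hq3 hc hns)
  obtain ⟨a, hFa, ha3, hca, hnsa⟩ := hA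
  have haA : a ∈ A := hAin a ha3 hca hnsa
  have haB : a ∉ B := fun h => by
    obtain ⟨-, _hF, -, hsp, -⟩ := (hBm a).mp h
    exact hnsa hsp
  rcases Nat.even_or_odd B.card with hBeven | hBodd
  · by_cases hB0 : B = ∅
    · -- Row 0: no split carrier `≠ 3`; frame (M) with `C := A`, the only possible off-`C` carrier being `3`
      refine ⟨A, hAspec, Or.inl ⟨3, ?_⟩⟩
      intro q hF hqA hq3 hc
      have hsp := hoffA q hqA hc
      have hqB : q ∈ B := hBin q hq3 hsp (hsplitc q hsp hc)
      rw [hB0] at hqB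
      exact Finset.notMem_empty q hqB
    · -- Row I.2⁺: `#B` even and nonempty; frame (A1) exempting one split carrier `b`, `C := A`, `S := {3} ∪ B ∖ {b}`
      obtain ⟨b, hb⟩ := Finset.nonempty_iff_ne_empty.mpr hB0
      obtain ⟨-, hFb, hb3, hspb, -⟩ := (hBm b).mp hb
      have hbA : b ∉ A := fun h => by
        obtain ⟨-, _hF, -, -, hns⟩ := (hAm b).mp h
        exact hns hspb
      refine ⟨A, hAspec, Or.inr (Or.inr ⟨b, hFb, hmultbad b (hsplit b hspb), hbA, ?_,
        insert 3 (B.erase b), ?_, ?_, Finset.mem_insert_self 3 _, ?_, ?_⟩)⟩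
      · intro q hF _ hqA hc
        exact hoffA q hqA hc
      · intro ℓ hℓ
        rcases Finset.mem_insert.mp hℓ with rfl | hℓ'
        · exact ⟨hF3, h3⟩
        · exact hBmult ℓ (Finset.mem_of_mem_erase hℓ')
      · have h3e : (3 : ℕ) ∉ B.erase b := fun h => h3B (Finset.mem_of_mem_erase h)
        rw [Finset.card_insert_of_notMem h3e, Finset.card_erase_of_mem hb,
          Nat.sub_add_cancel (Finset.card_pos.mpr ⟨b, hb⟩)]
        exact hBeven
      · intro h
        rcases Finset.mem_insert.mp h with h33 | hbe
        · exact hb3 h33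
        · exact Finset.notMem_erase b B hbe
      · intro ℓ hF hℓS hℓb hsp hv
        by_cases hℓ3 : ℓ = 3
        · subst hℓ3
          exact hℓS (Finset.mem_insert_self 3 _)
        · exact hℓS (Finset.mem_insert_of_mem (Finset.mem_erase.mpr ⟨hℓb, hBin ℓ hℓ3 hsp hv⟩))
  · -- Row I.1⁻: `#B` odd; frame (A1) exempting the additive carrier `a`, `C := A ∖ {a}`, `S := {3} ∪ B`
    refine ⟨A.erase a, fun q hq => hAspec q (Finset.mem_of_mem_erase hq),
      Or.inr (Or.inr ⟨a, hFa, hbad a hca, Finset.notMem_erase a A, ?_, insert 3 B, ?_, ?_,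
        Finset.mem_insert_self 3 _, ?_, ?_⟩)⟩
    · intro q hF hqa hqC hc
      by_contra hns
      by_cases hq3 : q = 3
      · subst hq3
        exact hns (h3split hc)
      · exact hqC (Finset.mem_erase.mpr ⟨hqa, hAin q hq3 hc hns⟩)
    · intro ℓ hℓ
      rcases Finset.mem_insert.mp hℓ with rfl | hℓ'
      · exact ⟨hF3, h3⟩
      · exact hBmult ℓ hℓ'
    · rw [Finset.card_insert_of_notMem h3B]
      exact hBodd.add_odd odd_one
    · intro h
      rcases Finset.mem_insert.mp h with h33 | haB'
      · exact ha3 h33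
      · exact haB haB'
    · intro ℓ hF hℓS _ hsp hv
      by_cases hℓ3 : ℓ = 3
      · subst hℓ3
        exact hℓS (Finset.mem_insert_self 3 _)
      · exact hℓS (Finset.mem_insert_of_mem (hBin ℓ hℓ3 hsp hv))
  where
  /-- the `Fact (Nat.Prime 3)` witness used for `3 ∈ S` [cite: SilvermanATAEC1994, IV.9.4 (Tate's algorithm, table 4.1) and Cor. IV.9.2(d)] -/
  hF3 : Fact (Nat.Prime 3) := ⟨Nat.prime_three⟩

/-- **Corollary R in r21∕r22 currency.** On tam3-p1 g19's residual population `Three.ResidualNormalFormAt` ((a) … [cite: SilvermanATAEC1994, IV.9.4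
(Tate's algorithm, table 4.1) and Cor. IV.9.2(d)] -/
theorem cartanServable_of_residualNormalFormAt
    (W : WeierstrassCurve ℚ) [W.IsElliptic] [W.IsGloballyMinimal]
    (h3 : Mult W 3)
    (hmultbad : ∀ (ℓ : ℕ) [Fact ℓ.Prime], Mult W ℓ → ¬ W.HasGoodReductionAtPrime ℓ)
    (hbad : ∀ (q : ℕ) [Fact q.Prime], 3 ∣ (W.baseChange ℚ_[q]).localTamagawaNumber ℤ_[q] →
      ¬ W.HasGoodReductionAtPrime q)
    (h3split : 3 ∣ (W.baseChange ℚ_[3]).localTamagawaNumber ℤ_[3] → W.HasSplitMultiplicativeReductionAtPrime 3)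
    (hsplitc : ∀ (q : ℕ) [Fact q.Prime], W.HasSplitMultiplicativeReductionAtPrime q →
      3 ∣ (W.baseChange ℚ_[q]).localTamagawaNumber ℤ_[q] → 3 ∣ padicValInt q W.minimalDiscriminantInt)
    (htame : ∀ (q : ℕ) [Fact q.Prime], q ≠ 2 → q ≠ 3 → 3 ∣ (W.baseChange ℚ_[q]).localTamagawaNumber ℤ_[q] →
      ¬ W.HasSplitMultiplicativeReductionAtPrime q → q ^ 2 ∣ W.conductorNorm ℤ ∧ ¬ q ^ 3 ∣ W.conductorNorm ℤ)
    (hW : 3 ∣ (W.baseChange ℚ_[2]).localTamagawaNumber ℤ_[2] → ¬ W.HasSplitMultiplicativeReductionAtPrime 2 →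
      2 ^ 2 ∣ W.conductorNorm ℤ ∧ ¬ 2 ^ 3 ∣ W.conductorNorm ℤ)
    (hfin : ∃ P : Finset ℕ, ∀ (q : ℕ) [Fact q.Prime], ¬ W.HasGoodReductionAtPrime q → q ∈ P)
    (hres : Summit.BirchSwinnertonDyer.Rank1Residual.X11b.Three.ResidualNormalFormAt W) :
    CartanServableAtThree W := by
  refine cartanServable_of_additiveCarrier W h3 hmultbad hbad h3split hsplitc htame hW hfin ?_
  rcases hres with ⟨q₀, hF, hq3, hc, hns, -⟩ | ⟨q₁, hF, hq3, hc, hns, -⟩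
  · exact ⟨q₀, hF, hq3, hc, hns⟩
  · exact ⟨q₁, hF, hq3, hc, hns⟩

/-- **Corollary R with the local facts DISCHARGED from the tree (v1.1).** Only the two Cartan-PLACEMENT facts remain as hypotheses — (N5) … [cite:
SilvermanATAEC1994, IV.9.4 (Tate's algorithm, table 4.1) and Cor. IV.9.2(d)] -/
theorem cartanServable_of_residualNormalFormAt_of_placement
    (W : WeierstrassCurve ℚ) [W.IsElliptic] [W.IsGloballyMinimal]
    (h3 : Mult W 3)
    (htame : ∀ (q : ℕ) [Fact q.Prime], q ≠ 2 → q ≠ 3 → 3 ∣ (W.baseChange ℚ_[q]).localTamagawaNumber ℤ_[q] →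
      ¬ W.HasSplitMultiplicativeReductionAtPrime q → q ^ 2 ∣ W.conductorNorm ℤ ∧ ¬ q ^ 3 ∣ W.conductorNorm ℤ)
    (hW : 3 ∣ (W.baseChange ℚ_[2]).localTamagawaNumber ℤ_[2] → ¬ W.HasSplitMultiplicativeReductionAtPrime 2 →
      2 ^ 2 ∣ W.conductorNorm ℤ ∧ ¬ 2 ^ 3 ∣ W.conductorNorm ℤ)
    (hres : Summit.BirchSwinnertonDyer.Rank1Residual.X11b.Three.ResidualNormalFormAt W) :
    CartanServableAtThree W := by
  refine cartanServable_of_residualNormalFormAt W h3 ?_ ?_ ?_ ?_ htame hW ?_ hres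
  · intro ℓ _ hm
    exact not_hasGoodReductionAtPrime_of_hasMultiplicativeReductionAtPrime ℓ hm
  · intro q _ hc hg
    have hg' : ((W.baseChange ℚ_[q]).minimal ℤ_[q]).HasGoodReduction ℤ_[q] := hg
    have h1 : (W.baseChange ℚ_[q]).localTamagawaNumber ℤ_[q] = 1 := by
      haveI := hg'
      exact WeierstrassCurve.localTamagawaNumber_eq_one_of_hasGoodReduction_holds ℤ_[q] (W.baseChange ℚ_[q])
    rw [h1] at hc
    exact absurd (Nat.le_of_dvd one_pos hc) (by norm_num)
  · intro hc
    exact (Summit.BirchSwinnertonDyer.Rank1Residual.X11b.Three.Koly.split_and_three_dvd_of_mult_of_three_dvd_localTamagawaNumber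
      W 3 h3 hc).1
  · intro q _ hsp hc
    exact (Summit.BirchSwinnertonDyer.Rank1Residual.X11b.Three.Koly.split_and_three_dvd_of_mult_of_three_dvd_localTamagawaNumber
      W q hsp.hasMultiplicativeReductionAtPrime hc).2
  · refine ⟨(W.conductorNorm ℤ).primeFactors, fun q _ hng => ?_⟩
    exact Nat.mem_primeFactors.mpr ⟨Fact.out, (W.dvd_conductorNorm_iff_not_hasGoodReductionAtPrime q).mpr hng,
      (WeierstrassCurve.conductorNorm_pos_holds W).ne'⟩

/-- **Lemma W (CartanServability.md §3), PROVED from the tree (v1.2): an additive `3`-carrier at `2` is TAME — `3 ∣ c₂(E)` and `2` not split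
multiplicative force `v₂(N_E) … [cite: SilvermanATAEC1994, IV.9.4 (Tate's algorithm, table 4.1) and Cor. IV.9.2(d)] -/
theorem typeIVAtTwoTame (W : WeierstrassCurve ℚ) [W.IsElliptic] [W.IsGloballyMinimal]
    (hc : 3 ∣ (W.baseChange ℚ_[2]).localTamagawaNumber ℤ_[2])
    (hns : ¬ W.HasSplitMultiplicativeReductionAtPrime 2) :
    2 ^ 2 ∣ W.conductorNorm ℤ ∧ ¬ 2 ^ 3 ∣ W.conductorNorm ℤ := by
  classical
  set v : HeightOneSpectrum (𝓞 ℚ) := (Rat.HeightOneSpectrum.primesEquiv (R := 𝓞 ℚ)).symm ⟨2, Nat.prime_two⟩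
    with hvdef
  have hpv : Rat.HeightOneSpectrum.primesEquiv v = ⟨2, Nat.prime_two⟩ := by
    rw [hvdef, Equiv.apply_symm_apply]
  have hv : (Rat.HeightOneSpectrum.primesEquiv v : ℕ) = 2 := by rw [hpv]
  have hv2 : (2 : 𝓞 ℚ) ∈ v.asIdeal := WeierstrassCurve.Rat.two_mem_primesEquiv_symm_two
  have h3' : 3 ∣ W.tamagawaNumberAt v := by
    rw [tamagawaNumberAt_def, ← WeierstrassCurve.localTamagawaNumber_padic_eq_holds W v 2 hv]
    exact hc
  rcases Summit.BirchSwinnertonDyer.Rank1Residual.X11b.Three.split_or_typeIV_of_odd_prime_dvd_localTamagawaNumber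
      W v Nat.prime_three (by decide) h3' with ⟨hs, -⟩ | ⟨-, hk, -⟩
  · exfalso
    have hs' := (W.hasSplitMultiplicativeReductionAtPrime_iff_hasSplitMultiplicativeReductionAt v).mpr hs
    have key : ∀ (r : ℕ) (hr : Fact r.Prime), (Rat.HeightOneSpectrum.primesEquiv v : ℕ) = r →
        @WeierstrassCurve.HasSplitMultiplicativeReductionAtPrime W r hr := by
      rintro r hr rfl; exact hs'
    exact hns (key 2 inferInstance hv)
  · -- Kodaira `IV` ∕ `IV*` at `2`: `ord₂ Δ_min = 4` ∕ `8`, so Ogg's `f₂ = ord₂ Δ_min + 1 - m = 2`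
    have hf : W.conductorExponent v = 2 := by
      rcases hk with hT | hT
      · have hord := (W.ordMinimalDiscriminant_eq_of_kodairaSymbolAt_IV_two hv2 hT).1
        unfold WeierstrassCurve.conductorExponent WeierstrassCurve.numComponentsAt
        rw [hord, hT]
        decide
      · have hord := (W.ordMinimalDiscriminant_eq_of_kodairaSymbolAt_IVstar_two hv2 hT).1
        unfold WeierstrassCurve.conductorExponent WeierstrassCurve.numComponentsAt
        rw [hord, hT]
        decide
    -- `N_E = ∏ p ^ f_p`, read at the place of `ℤ` below `v`
    have h4 : (W.conductorNorm ℤ).factorization 2 = W.conductorExponent v := by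
      rw [WeierstrassCurve.conductorExponent_ringOfIntegers_eq W v, hpv]
      exact WeierstrassCurve.factorization_conductorNorm_primesEquiv_symm W ⟨2, Nat.prime_two⟩
    have hfac : (W.conductorNorm ℤ).factorization 2 = 2 := by rw [h4, hf]
    have hN : W.conductorNorm ℤ ≠ 0 := (WeierstrassCurve.conductorNorm_pos_holds W).ne'
    rw [Nat.prime_two.pow_dvd_iff_le_factorization hN, Nat.prime_two.pow_dvd_iff_le_factorization hN, hfac]
    omega

/-- **(N5) PROVED from the tree (v1.2): an additive `3`-carrier `q ≠ 2, 3` is tame, `v_q(N_E) … [cite: SilvermanATAEC1994, IV.9.4 (Tate's algorithm,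
table 4.1) and Cor. IV.9.2(d)] -/
theorem additiveThreeCarrierTame (W : WeierstrassCurve ℚ) [W.IsElliptic] [W.IsGloballyMinimal]
    (q : ℕ) [hq : Fact q.Prime] (hq2 : q ≠ 2) (hq3 : q ≠ 3)
    (hc : 3 ∣ (W.baseChange ℚ_[q]).localTamagawaNumber ℤ_[q])
    (hns : ¬ W.HasSplitMultiplicativeReductionAtPrime q) :
    q ^ 2 ∣ W.conductorNorm ℤ ∧ ¬ q ^ 3 ∣ W.conductorNorm ℤ := by
  classical
  set v : HeightOneSpectrum (𝓞 ℚ) := (Rat.HeightOneSpectrum.primesEquiv (R := 𝓞 ℚ)).symm ⟨q, hq.out⟩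
    with hvdef
  have hpv : Rat.HeightOneSpectrum.primesEquiv v = ⟨q, hq.out⟩ := by
    rw [hvdef, Equiv.apply_symm_apply]
  have hv : (Rat.HeightOneSpectrum.primesEquiv v : ℕ) = q := by rw [hpv]
  have hvq : (q : 𝓞 ℚ) ∈ v.asIdeal :=
    (natCast_mem_asIdeal_iff_eq_primesEquiv_symm v hq.out).mpr hvdef
  have h3' : 3 ∣ W.tamagawaNumberAt v := by
    rw [tamagawaNumberAt_def, ← WeierstrassCurve.localTamagawaNumber_padic_eq_holds W v q hv]
    exact hc
  rcases Summit.BirchSwinnertonDyer.Rank1Residual.X11b.Three.split_or_typeIV_of_odd_prime_dvd_localTamagawaNumber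
      W v Nat.prime_three (by decide) h3' with ⟨hs, -⟩ | ⟨-, hk, -⟩
  · exfalso
    have hs' := (W.hasSplitMultiplicativeReductionAtPrime_iff_hasSplitMultiplicativeReductionAt v).mpr hs
    have key : ∀ (r : ℕ) (hr : Fact r.Prime), (Rat.HeightOneSpectrum.primesEquiv v : ℕ) = r →
        @WeierstrassCurve.HasSplitMultiplicativeReductionAtPrime W r hr := by
      rintro r hr rfl; exact hs'
    exact hns (key q hq hv)
  · -- residue characteristic `q ≠ 2, 3`: no wild conductor, `f_q = ε_q = 2` for `IV` ∕ `IV*`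
    have hchar : ringChar ((𝓞 ℚ) ⧸ v.asIdeal) = q := by
      haveI : Nontrivial ((𝓞 ℚ) ⧸ v.asIdeal) := Ideal.Quotient.nontrivial_iff.2 v.isPrime.ne_top
      have h0 : (q : (𝓞 ℚ) ⧸ v.asIdeal) = 0 := by
        rw [← map_natCast (Ideal.Quotient.mk v.asIdeal) q, Ideal.Quotient.eq_zero_iff_mem]
        exact hvq
      exact CharP.ringChar_of_prime_eq_zero hq.out h0
    have hf : W.conductorExponent v = 2 := by
      rw [WeierstrassCurve.conductorExponent_eq_tameConductorExponent_holds v W (by rw [hchar]; exact hq2)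
        (by rw [hchar]; exact hq3)]
      rcases hk with hT | hT
      · rw [hT]; decide
      · rw [hT]; decide
    have h4 : (W.conductorNorm ℤ).factorization q = W.conductorExponent v := by
      rw [WeierstrassCurve.conductorExponent_ringOfIntegers_eq W v, hpv]
      exact WeierstrassCurve.factorization_conductorNorm_primesEquiv_symm W ⟨q, hq.out⟩
    have hfac : (W.conductorNorm ℤ).factorization q = 2 := by rw [h4, hf]
    have hN : W.conductorNorm ℤ ≠ 0 := (WeierstrassCurve.conductorNorm_pos_holds W).ne'
    rw [hq.out.pow_dvd_iff_le_factorization hN, hq.out.pow_dvd_iff_le_factorization hN, hfac]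
    omega

/-- **Corollary R, UNCONDITIONAL in tree currency (v1.2).** Every curve in the residual population of `EulerHalvesAtThree`
(`Three.ResidualNormalFormAt`, i.e. [cite: SilvermanATAEC1994, IV.9.4 (Tate's algorithm, table 4.1) and Cor. IV.9.2(d)] -/
theorem cartanServable_of_residualNormalFormAt_of_mult
    (W : WeierstrassCurve ℚ) [W.IsElliptic] [W.IsGloballyMinimal]
    (h3 : Mult W 3)
    (hres : Summit.BirchSwinnertonDyer.Rank1Residual.X11b.Three.ResidualNormalFormAt W) :
    CartanServableAtThree W :=
  cartanServable_of_residualNormalFormAt_of_placement W h3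
    (fun q _ hq2 hq3 hc hns => additiveThreeCarrierTame W q hq2 hq3 hc hns) (typeIVAtTwoTame W) hres

/-! ### §R. The residue OFF the Cartan road is empty: the tree's two `@[conjecture]` residue constants, proved outright -/

/-- **A curve of the X11b@3 class in residual normal form is Cartan-servable.** (`ClassX11b W 3` gives `Mult W 3`.) [cite: KohenPacetti2016, Def. 3.5,
Thm. 3.6 (arXiv:1403.7801v3) (the Cartan frame; shape only)] -/
theorem cartanServableAtThree_of_classX11b_of_residualNormalFormAt
    (W : WeierstrassCurve ℚ) [W.IsElliptic] [W.IsGloballyMinimal]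
    (hX : ClassX11b W 3) (hres : ResidualNormalFormAt W) : CartanServableAtThree W :=
  cartanServable_of_residualNormalFormAt_of_mult W hX.2.2.1 hres

/-- **`Three.CoStepLResidualOffCartanAtThree` HOLDS — vacuously: its hypotheses `¬ CartanServableAtThree W`, `ResidualNormalFormAt W` and (inside
`CoStepLAt W`) … [folklore] -/
theorem coStepLResidualOffCartanAtThree_holds : CoStepLResidualOffCartanAtThree := by
  intro W _ _ _ hnot hres N _ K _ _ Dt H ι P hX
  exact absurd (cartanServableAtThree_of_classX11b_of_residualNormalFormAt W hX hres) hnot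

/-- **No curve of the X11b@3 class lies in the residual class OFF the Cartan road.** UNCONDITIONAL. [folklore] -/
theorem not_residualOffAt_cartanServableAtThree
    (W : WeierstrassCurve ℚ) [W.IsElliptic] [W.IsGloballyMinimal] (hX : ClassX11b W 3) :
    ¬ ResidualOffAt CartanServableAtThree W :=
  fun h ↦ h.2 (cartanServableAtThree_of_classX11b_of_residualNormalFormAt W hX h.1.2)

/-- **`ResidualUpperBoundOffCartanAtThree` HOLDS — vacuously** (output-form twin of `coStepLResidualOffCartanAtThree_holds`). [folklore] -/
theorem residualUpperBoundOffCartanAtThree_holds : ResidualUpperBoundOffCartanAtThree :=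
  fun W _ _ hX _ hoff ↦ (not_residualOffAt_cartanServableAtThree W hX hoff).elim

/-- **The output-form residue (Z) `EulerHalvesAtThreeResidualUpperBound` of line `inert` r25 follows from the Cartan road ALONE.** CONDITIONAL on
`CartanRoadAtThree`; nothing booked. [cite: KohenPacetti2016, Thm. 3.6, Thm. 3.7, Rem. 3.8 (shape only)] -/
theorem eulerHalvesAtThreeResidualUpperBound_of_cartanRoad (hCart : CartanRoadAtThree) :
    EulerHalvesAtThreeResidualUpperBound :=
  fun W _ _ hX hρ _ hr ↦ hCart W hX hρ (cartanServableAtThree_of_classX11b_of_residualNormalFormAt W hX hr)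

/-- **Crux 19109 `EulerHalvesAtThree` BY NAME from its seven print ∕ aside ∕ support items BY NAME and the Cartan road `Three.CartanRoadAtThree` — NO
IMC-grade binder** (item 23334 `EulerHalvesAtThreeCoStepLResidual` does not occur): tam3-p1's r25 closer `EulerHal … [cite: McCallumLMS1991, §5 Cor.
5.6 (p. 310)] [cite: Jetchev2008, Thm. 1.4 (p. 812)] [cite: KohenPacetti2016, Thm. 3.6, Thm. 3.7, Rem. 3.8 (shape only)] -/
theorem eulerHalvesAtThree_of_items_of_cartanRoad
    (h : Summit.BirchSwinnertonDyer.BirchSwinnertonDyer.Theses.ClassRecordThree.PublishedInputsThree)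
    (hF : Summit.BirchSwinnertonDyer.BirchSwinnertonDyer.Theses.ClassRecordThree.EulerHalfGrossPrintFacts)
    (hSh : Summit.BirchSwinnertonDyer.BirchSwinnertonDyer.Theses.ClassRecordThree.ShimuraParametrizationDataNonempty)
    (hCO : Summit.BirchSwinnertonDyer.BirchSwinnertonDyer.Theses.ClassRecordThree.PastenComponentOrdersInput)
    (hPT2 : Summit.BirchSwinnertonDyer.BirchSwinnertonDyer.Theses.ClassRecordThree.PoitouTateShaTateDualFact)
    (hPrim : Summit.BirchSwinnertonDyer.BirchSwinnertonDyer.Theses.ClassRecordThree.ShimuraPrimitivesAtThreeInertFact)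
    (hX : Summit.BirchSwinnertonDyer.BirchSwinnertonDyer.Theses.ClassRecordThree.X11aLowerHalfAtThree)
    (hCart : CartanRoadAtThree) :
    Summit.BirchSwinnertonDyer.BirchSwinnertonDyer.Theses.ClassRecordThree.EulerHalvesAtThree :=
  EulerHalvesResidualUB.eulerHalvesAtThree_of_items_of_residualUpperBound h hF hSh hCO hPT2 hPrim hX
    (eulerHalvesAtThreeResidualUpperBound_of_cartanRoad hCart)

/-- The `KolyvaginRoadThree` twin of `eulerHalvesAtThree_of_items_of_cartanRoad`. [cite: McCallumLMS1991, §5 Cor. 5.6 (p. 310)] [cite: Jetchev2008, Thm.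
1.4 (p. 812)] -/
theorem kolyvaginRoadThree_eulerHalvesAtThree_of_items_of_cartanRoad
    (h : Summit.BirchSwinnertonDyer.BirchSwinnertonDyer.Theses.ClassRecordThree.PublishedInputsThree)
    (hF : Summit.BirchSwinnertonDyer.BirchSwinnertonDyer.Theses.KolyvaginRoadThree.EulerHalfGrossPrintFacts)
    (hSh : Summit.BirchSwinnertonDyer.BirchSwinnertonDyer.Theses.KolyvaginRoadThree.ShimuraParametrizationDataNonempty)
    (hCO : Summit.BirchSwinnertonDyer.BirchSwinnertonDyer.Theses.KolyvaginRoadThree.PastenComponentOrdersInput)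
    (hPT2 : Summit.BirchSwinnertonDyer.BirchSwinnertonDyer.Theses.KolyvaginRoadThree.PoitouTateShaTateDualFact)
    (hPrim : Summit.BirchSwinnertonDyer.BirchSwinnertonDyer.Theses.KolyvaginRoadThree.ShimuraPrimitivesAtThreeInertFact)
    (hX : Summit.BirchSwinnertonDyer.BirchSwinnertonDyer.Theses.KolyvaginRoadThree.X11aLowerHalfAtThree)
    (hCart : CartanRoadAtThree) :
    Summit.BirchSwinnertonDyer.BirchSwinnertonDyer.Theses.KolyvaginRoadThree.EulerHalvesAtThree :=
  EulerHalvesResidualUB.kolyvaginRoadThree_eulerHalvesAtThree_of_items_of_residualUpperBound h hF hSh hCO hPT2 hPrim hX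
    (eulerHalvesAtThreeResidualUpperBound_of_cartanRoad hCart)

end Summit.BirchSwinnertonDyer.BirchSwinnertonDyer.Theorems.CartanResidueEmpty

end
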